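import Mathlib

/-!
# Positive-definite trace forms turn Gram-kernel vectors into relations

Solo (informed) seat, s20 — the algebraic sentence behind the RELATION TEST of the level-one Hilbert
modular form engine (Part II §7.11 (15)(b), ATTEMPTS A64(d)).  If `τ` is an additive map on a
commutative ring `A` with `τ (x * x) > 0` for every `x ≠ 0` (for the Hecke algebra of a space of cusp
forms with totally real Hecke fields, `τ` = the trace of multiplication), and `t₁, …, tₘ ∈ A`
(Hecke operators `T(𝔞)`), then every INTEGER vector `c` in the kernel of the Gram matrix
`G_{uv} = τ (t_u * t_v)` is a genuine relation `∑ c_u • t_u = 0` in `A`.  Applying a ring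
homomorphism `A → k` (an eigencharacter) to such a relation is what makes "one violated congruence
`∑ c_u σ₁(𝔞_u) ≢ 0 (mod p)`" a rigorous refutation of an Eisenstein eigensystem.
-/

namespace Summit.Langlands.Langlands.Theorems

open Finset

/-- The value of a `ℤ`-valued-coefficient quadratic expression under an additive map:
`τ ((∑ c_u • t_u) * (∑ c_v • t_v)) = ∑_v c_v * ∑_u c_u * τ (t_u * t_v)`. -/
theorem soloInformed_trace_sq_expand {A : Type*} [CommRing A] (τ : A →+ ℝ) {m : ℕ}
    (t : Fin m → A) (c : Fin m → ℤ) :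
    τ ((∑ u, c u • t u) * (∑ v, c v • t v)) = ∑ v, (c v : ℝ) * ∑ u, (c u : ℝ) * τ (t u * t v) := by
  have h1 : (∑ u, c u • t u) * (∑ v, c v • t v) = ∑ v, c v • ∑ u, c u • (t u * t v) := by
    rw [Finset.mul_sum]
    refine Finset.sum_congr rfl fun v _ => ?_
    rw [mul_smul_comm, Finset.sum_mul]
    congr 1
    refine Finset.sum_congr rfl fun u _ => ?_
    rw [smul_mul_assoc]
  rw [h1, map_sum]
  refine Finset.sum_congr rfl fun v _ => ?_
  rw [map_zsmul, map_sum, zsmul_eq_mul]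
  congr 1
  refine Finset.sum_congr rfl fun u _ => ?_
  rw [map_zsmul, zsmul_eq_mul]

/-- **Gram-kernel vectors are relations.**  For an additive `τ : A →+ ℝ` on a commutative ring with
`τ (x * x) > 0` whenever `x ≠ 0`, an integer vector `c` with `∑_u c_u τ (t_u t_v) = 0` for every `v`
satisfies `∑_u c_u • t_u = 0`. -/
theorem soloInformed_gramKernel_isRelation {A : Type*} [CommRing A] (τ : A →+ ℝ)
    (hpos : ∀ x : A, x ≠ 0 → 0 < τ (x * x)) {m : ℕ} (t : Fin m → A) (c : Fin m → ℤ)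
    (hG : ∀ v, ∑ u, (c u : ℝ) * τ (t u * t v) = 0) :
    ∑ u, c u • t u = 0 := by
  by_contra h
  have hp := hpos _ h
  rw [soloInformed_trace_sq_expand τ t c] at hp
  simp only [hG, mul_zero, Finset.sum_const_zero, lt_self_iff_false] at hp

/-- The refutation step: a relation `∑ c_u • t_u = 0` is respected by every ring homomorphism
`χ : A →+* k` (an eigencharacter): `∑ c_u • χ (t_u) = 0`.  Contrapositive: if the putative
eigenvalues `λ_u` satisfy `∑ c_u • λ_u ≠ 0` in `k`, no eigencharacter with `χ (t_u) = λ_u` exists. -/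
theorem soloInformed_no_eigencharacter_of_violated_relation {A k : Type*} [CommRing A] [CommRing k]
    {m : ℕ} (t : Fin m → A) (c : Fin m → ℤ) (hrel : ∑ u, c u • t u = 0) (lam : Fin m → k)
    (hviol : ∑ u, c u • lam u ≠ 0) : ¬ ∃ χ : A →+* k, ∀ u, χ (t u) = lam u := by
  rintro ⟨χ, hχ⟩
  apply hviol
  have := congrArg χ hrel
  rw [map_sum, map_zero] at this
  simpa [map_zsmul, hχ] using this

end Summit.Langlands.Langlands.Theorems
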